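import Mathlib
import Summits.PneNP.PneNP.Theorems.ConvexRankGatesConvexGateBlindColumnSpaceFifth
import Summits.PneNP.PneNP.Theorems.ConvexRankGatesConvexGateBlindRankPlusOne
import Summits.PneNP.PneNP.Theorems.ConvexRankGatesConvexGateBlindConicSupport

/-!
# PneNP / ConvexRankGates — `ConvexGateBlind`: the CODIMENSION theorem for unrestricted LP factorisations (fixed `m`)

Helpers (`--supports stmt-PneNP-10680`), COLUMN-SPACE line (prover seat 2, session 23).

Let `cdist Q u − ε = ∑_{l<R} U_l(u)·V_l(Q)` (`U ≥ 0`, `V_l ≥ 0` on `k`-sets, all `k`-sets `Q`, all `k`-clique-free `u`) be ANY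
non-negative factorisation of the LP slice of the crux, and let `W = X(ℝ^E) = span{Q ↦ [e ⊆ Q]}` be the column space of the
clique-distance matrix (`dim W = C(m,2)`). Suppose the row objects have CODIMENSION-DEFECT `≤ p` over `W`: every `p + 1`
of the `V_l` admit a non-trivial linear combination lying in `W` (equivalently `dim(span{V_l} + W) ≤ C(m,2) + p`). Then

    (k−1)^m − (k−1) ≤ (R + 1)^{p+1} · (k−1)^m · θ

for every catch bound `θ` of `k`-clique-non-negative edge weightings (`codim_terms_lower_bound_of_catch`). PROOF. Work in
the quotient `F ⧸ W` (`F` = functions on `k`-sets): the images `ȳ_l` of the row objects have the property that every `p+1`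
of them are linearly related, and every row `a_u = U(u,·) ≥ 0` is a non-negative relation (`∑ a_u(l) ȳ_l = 0`, because
`cdist(·,u) − ε ∈ W`). By the support-canonical conic Carathéodory lemma (`…ConicSupport.exists_conic_decomposition`)
each `a_u` is a non-negative combination of canonical generators `g_T`, one per support `T ⊆ Fin R` with `#T ≤ p+1`; each
`V_T := ∑_l g_T(l) V_l` is `≥ 0` on `k`-sets AND lies in `W`, i.e. `V_T = X t_T` with `t_T` `k`-clique-non-negative. This
REWRITES the factorisation as a RESTRICTED one with `#{T : #T ≤ p+1} ≤ (R+1)^{p+1}` terms, and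
`restricted_terms_lower_bound_of_catch` (the column-space theorem with an abstract catch bound) finishes. [new]
-/

set_option linter.dupNamespace false

namespace Summit.PneNP.PneNP.Theorems

open Finset Real Filter Literature.Computability.Complexity
open Summit.PneNP.PneNP.Cruxes.ConvexGateBlind.StrictRankConicCover (Edge cdist)

noncomputable section

variable {m : ℕ}

/-! ## Counting supports -/

/-- `#{T ⊆ Fin R : #T ≤ p + 1} ≤ (R + 1)^{p+1}`. [folklore] -/
theorem card_subtype_card_le_pow (R p : ℕ) :
    Fintype.card {T : Finset (Fin R) // T.card ≤ p + 1} ≤ (R + 1) ^ (p + 1) := by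
  classical
  rw [Fintype.card_subtype]
  have hsub : (Finset.univ.filter fun T : Finset (Fin R) => T.card ≤ p + 1) ⊆
      (Finset.range (p + 2)).biUnion fun j => (Finset.univ : Finset (Fin R)).powersetCard j := by
    intro T hT
    rw [Finset.mem_filter] at hT
    rw [Finset.mem_biUnion]
    exact ⟨T.card, Finset.mem_range.2 (by omega), Finset.mem_powersetCard.2 ⟨Finset.subset_univ _, rfl⟩⟩
  calc (Finset.univ.filter fun T : Finset (Fin R) => T.card ≤ p + 1).card
      ≤ ((Finset.range (p + 2)).biUnion fun j => (Finset.univ : Finset (Fin R)).powersetCard j).card :=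
        Finset.card_le_card hsub
    _ ≤ ∑ j ∈ Finset.range (p + 2), ((Finset.univ : Finset (Fin R)).powersetCard j).card := Finset.card_biUnion_le
    _ = ∑ j ∈ Finset.range (p + 2), R.choose j := by
        refine Finset.sum_congr rfl fun j _ => ?_
        rw [Finset.card_powersetCard, Finset.card_univ, Fintype.card_fin]
    _ ≤ ∑ j ∈ Finset.range (p + 1 + 1), R ^ j * 1 ^ (p + 1 - j) * (p + 1).choose j := by
        refine Finset.sum_le_sum fun j hj => ?_
        rw [one_pow, mul_one]
        have h1 : R.choose j ≤ R ^ j := Nat.choose_le_pow R j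
        have h2 : 1 ≤ (p + 1).choose j := Nat.choose_pos (by rw [Finset.mem_range] at hj; omega)
        nlinarith
    _ = (R + 1) ^ (p + 1) := (add_pow R 1 (p + 1)).symm

/-! ## The codimension theorem at fixed `m` (abstract catch bound) -/

/-- **Codimension theorem (fixed `m`, abstract catch bound).** Let `3 ≤ k`, `k + 2 ≤ m`, `ε > 0`, and let
`cdist Q u − ε = ∑_{l<R} U_l(u) V_l(Q)` for all `k`-sets `Q` and all `k`-clique-free `u`, with `U ≥ 0` and `V_l ≥ 0` on `k`-sets.
Suppose every `p + 1` of the row objects have a non-trivial linear combination that is a clique sum `t(E(Q))` on `k`-sets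
(codimension defect `≤ p` over the column space), and that every `k`-clique-non-negative weighting catches at most
`(k−1)^m·θ` colourings. Then `(k−1)^m − (k−1) ≤ (R+1)^{p+1}·((k−1)^m·θ)`. [new] -/
theorem codim_terms_lower_bound_of_catch {k R p : ℕ} (hk : 3 ≤ k) (hm : k + 2 ≤ m)
    (U : (Edge m → Bool) → Fin R → ℝ) (V : Fin R → Finset (Fin m) → ℝ)
    (hU : ∀ u l, 0 ≤ U u l) (hV : ∀ l (Q : Finset (Fin m)), Q.card = k → 0 ≤ V l Q) (ε : ℝ) (hε : 0 < ε)
    (hfact : ∀ (Q : Finset (Fin m)) (u : Edge m → Bool), Q.card = k → cliqueFn m k u = false →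
      cdist Q u - ε = ∑ l, U u l * V l Q)
    (hP : ∀ s : Finset (Fin R), s.card = p + 1 → ∃ h : Fin R → ℝ, (∀ l, l ∉ s → h l = 0) ∧ h ≠ 0 ∧
      ∃ t : Edge m → ℝ, ∀ Q : Finset (Fin m), Q.card = k →
        ∑ l, h l * V l Q = ∑ e, (if cliqueVec Q e = true then t e else 0))
    (θ : ℝ) (hcatch : ∀ w : Edge m → ℝ, (∀ Q ∈ (Finset.univ : Finset (Fin m)).powersetCard k, 0 ≤ softWindow w Q) →
      ((((Finset.univ : Finset (Fin m → Fin (k - 1))).filter fun c =>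
        ∑ e, (if colorVec c e = true then w e else 0) < 0).card : ℝ)) ≤ ((k - 1 : ℕ) : ℝ) ^ m * θ) :
    ((k - 1 : ℕ) : ℝ) ^ m - ((k - 1 : ℕ) : ℝ) ≤ ((R : ℝ) + 1) ^ (p + 1) * (((k - 1 : ℕ) : ℝ) ^ m * θ) := by
  classical
  -- ambient space of functions on `k`-sets, the pair-inclusion map and the column space
  set X : (Edge m → ℝ) →ₗ[ℝ] ({Q : Finset (Fin m) // Q.card = k} → ℝ) :=
    { toFun := fun t Q => ∑ e, (if cliqueVec Q.1 e = true then t e else 0)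
      map_add' := fun t t' => by
        funext Q
        simp only [Pi.add_apply, ← Finset.sum_add_distrib]
        exact Finset.sum_congr rfl fun e _ => by split_ifs <;> simp
      map_smul' := fun a t => by
        funext Q
        simp only [Pi.smul_apply, smul_eq_mul, RingHom.id_apply, Finset.mul_sum]
        exact Finset.sum_congr rfl fun e _ => by split_ifs <;> simp } with hX
  have hXapply : ∀ (t : Edge m → ℝ) (Q : {Q : Finset (Fin m) // Q.card = k}),
      X t Q = ∑ e, (if cliqueVec Q.1 e = true then t e else 0) := fun t Q => rfl
  set W : Submodule ℝ ({Q : Finset (Fin m) // Q.card = k} → ℝ) := LinearMap.range X with hW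
  -- row objects as vectors, and their images in the quotient
  set Vf : Fin R → ({Q : Finset (Fin m) // Q.card = k} → ℝ) := fun l Q => V l Q.1 with hVf
  set y : Fin R → ({Q : Finset (Fin m) // Q.card = k} → ℝ) ⧸ W := fun l => W.mkQ (Vf l) with hy
  have hcomb : ∀ (h : Fin R → ℝ) (Q : {Q : Finset (Fin m) // Q.card = k}),
      (∑ l, h l • Vf l) Q = ∑ l, h l * V l Q.1 := by
    intro h Q
    rw [Finset.sum_apply]
    exact Finset.sum_congr rfl fun l _ => by rw [Pi.smul_apply, smul_eq_mul]
  have hy_comb : ∀ h : Fin R → ℝ, ∑ l, h l • y l = W.mkQ (∑ l, h l • Vf l) := by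
    intro h
    rw [map_sum]
    exact Finset.sum_congr rfl fun l _ => by rw [map_smul]
  have hrel_iff : ∀ h : Fin R → ℝ, ∑ l, h l • y l = 0 ↔ ∃ t : Edge m → ℝ, X t = ∑ l, h l • Vf l := by
    intro h
    rw [hy_comb, Submodule.mkQ_apply, Submodule.Quotient.mk_eq_zero, hW, LinearMap.mem_range]
  -- every `p + 1` row objects are related in the quotient
  have hp : ∀ s : Finset (Fin R), s.card = p + 1 →
      ∃ h : Fin R → ℝ, (∀ l, l ∉ s → h l = 0) ∧ h ≠ 0 ∧ ∑ l, h l • y l = 0 := by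
    intro s hs
    obtain ⟨h, hhs, hhne, t, ht⟩ := hP s hs
    refine ⟨h, hhs, hhne, (hrel_iff h).2 ⟨t, funext fun Q => ?_⟩⟩
    rw [hXapply, hcomb, ht Q.1 Q.2]
  -- rows are non-negative relations
  have hk2 : 0 < (k.choose 2 : ℝ) := by exact_mod_cast Nat.choose_pos (by omega)
  have hrow : ∀ u : Edge m → Bool, cliqueFn m k u = false → ∑ l, U u l • y l = 0 := by
    intro u hu
    rw [hrel_iff]
    refine ⟨fun e => (if u e = false then (1 : ℝ) else 0) - ε / (k.choose 2 : ℝ), funext fun Q => ?_⟩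
    rw [hXapply, hcomb, ← hfact Q.1 u Q.2 hu]
    unfold cdist
    have hsplit : ∀ e : Edge m, (if cliqueVec Q.1 e = true then
        ((if u e = false then (1 : ℝ) else 0) - ε / (k.choose 2 : ℝ)) else 0) =
        (if cliqueVec Q.1 e = true ∧ u e = false then (1 : ℝ) else 0) -
          (ε / (k.choose 2 : ℝ)) * (if cliqueVec Q.1 e = true then (1 : ℝ) else 0) := by
      intro e
      by_cases h1 : cliqueVec Q.1 e = true <;> by_cases h2 : u e = false <;> simp [h1, h2]
    rw [Finset.sum_congr rfl fun e _ => hsplit e, Finset.sum_sub_distrib, ← Finset.mul_sum,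
      sum_ite_cliqueVec_eq_choose, Q.2]
    field_simp
  -- canonical generators and their clique-sum representatives
  set g : Finset (Fin R) → Fin R → ℝ := ConicSupport.canonGen y with hg
  have hgW : ∀ T : Finset (Fin R), ∃ t : Edge m → ℝ, X t = ∑ l, g T l • Vf l :=
    fun T => (hrel_iff (g T)).1 (ConicSupport.sum_canonGen_smul y T)
  choose tT htT using hgW
  -- decompositions of the rows
  have hdec : ∀ u : Edge m → Bool, cliqueFn m k u = false → ∃ lam : Finset (Fin R) → ℝ,
      (∀ T, 0 ≤ lam T) ∧ (∀ T, p + 1 < T.card → lam T = 0) ∧ ∀ l, U u l = ∑ T, lam T * g T l :=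
    fun u hu => ConicSupport.exists_conic_decomposition y p hp (U u) (hU u) (hrow u hu)
  -- the restricted factorisation, indexed by supports of size `≤ p + 1`
  set N : ℕ := Fintype.card {T : Finset (Fin R) // T.card ≤ p + 1} with hN
  set eqv := Fintype.equivFin {T : Finset (Fin R) // T.card ≤ p + 1} with heqv
  set t' : Fin N → Edge m → ℝ := fun i => tT (eqv.symm i).1 with ht'
  set b' : (Edge m → Bool) → Fin N → ℝ := fun u i =>
    if hu : cliqueFn m k u = false then Classical.choose (hdec u hu) (eqv.symm i).1 else 0 with hb'
  have ht'valid : ∀ i (Q : Finset (Fin m)), Q.card = k → 0 ≤ ∑ e, if cliqueVec Q e = true then t' i e else 0 := by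
    intro i Q hQ
    have h := congrFun (htT (eqv.symm i).1) ⟨Q, hQ⟩
    rw [hXapply, hcomb] at h
    rw [ht']
    dsimp only
    rw [h]
    exact Finset.sum_nonneg fun l _ => mul_nonneg (ConicSupport.canonGen_nonneg y _ l) (hV l Q hQ)
  have hb'nn : ∀ u i, 0 ≤ b' u i := by
    intro u i
    rw [hb']
    dsimp only
    split_ifs with hu
    · exact (Classical.choose_spec (hdec u hu)).1 _
    · exact le_rfl
  have hfact' : ∀ (Q : Finset (Fin m)) (u : Edge m → Bool), Q.card = k → cliqueFn m k u = false →
      cdist Q u - ε = ∑ i, b' u i * ∑ e, (if cliqueVec Q e = true then t' i e else 0) := by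
    intro Q u hQ hu
    obtain ⟨hlam0, hlambig, hlam⟩ := Classical.choose_spec (hdec u hu)
    set lam := Classical.choose (hdec u hu) with hlamdef
    -- rewrite the right-hand side as a sum over all supports
    have hterm : ∀ T : Finset (Fin R), (∑ e, if cliqueVec Q e = true then tT T e else 0) = ∑ l, g T l * V l Q := by
      intro T
      have h := congrFun (htT T) ⟨Q, hQ⟩
      rw [hXapply, hcomb] at h
      exact h
    have hrhs : ∑ i, b' u i * ∑ e, (if cliqueVec Q e = true then t' i e else 0) =
        ∑ T : {T : Finset (Fin R) // T.card ≤ p + 1}, lam T.1 * ∑ l, g T.1 l * V l Q := by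
      rw [← eqv.symm.sum_comp]
      refine Finset.sum_congr rfl fun i _ => ?_
      rw [hb', ht']
      dsimp only
      rw [dif_pos hu, hterm]
    have hall : ∑ T : {T : Finset (Fin R) // T.card ≤ p + 1}, lam T.1 * ∑ l, g T.1 l * V l Q =
        ∑ T : Finset (Fin R), lam T * ∑ l, g T l * V l Q := by
      have hsub := Finset.sum_subtype (Finset.univ.filter fun T : Finset (Fin R) => T.card ≤ p + 1)
          (p := fun T : Finset (Fin R) => T.card ≤ p + 1) (F := inferInstance) (fun T => by simp)
          (fun T : Finset (Fin R) => lam T * ∑ l, g T l * V l Q)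
      rw [← Finset.sum_filter_add_sum_filter_not Finset.univ (fun T : Finset (Fin R) => T.card ≤ p + 1), hsub]
      rw [Finset.sum_eq_zero (s := Finset.univ.filter fun T : Finset (Fin R) => ¬ T.card ≤ p + 1), add_zero]
      intro T hT
      rw [Finset.mem_filter] at hT
      rw [hlambig T (by omega), zero_mul]
    rw [hrhs, hall, hfact Q u hQ hu]
    -- swap sums
    calc ∑ l, U u l * V l Q = ∑ l, (∑ T, lam T * g T l) * V l Q :=
          Finset.sum_congr rfl fun l _ => by rw [hlam l]
      _ = ∑ l, ∑ T, lam T * (g T l * V l Q) := by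
          refine Finset.sum_congr rfl fun l _ => ?_
          rw [Finset.sum_mul]
          exact Finset.sum_congr rfl fun T _ => by ring
      _ = ∑ T, ∑ l, lam T * (g T l * V l Q) := Finset.sum_comm
      _ = ∑ T, lam T * ∑ l, g T l * V l Q := Finset.sum_congr rfl fun T _ => by rw [Finset.mul_sum]
  -- the column-space count
  have hlb := restricted_terms_lower_bound_of_catch hk hm t' ht'valid b' hb'nn ε hε hfact' θ hcatch
  -- `θ ≥ 0` (from the zero weighting) and `N ≤ (R+1)^{p+1}`
  have hθ : 0 ≤ ((k - 1 : ℕ) : ℝ) ^ m * θ := by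
    have h := hcatch 0 fun Q _ => by simp [softWindow]
    exact le_trans (by positivity) h
  have hNle : (N : ℝ) ≤ ((R : ℝ) + 1) ^ (p + 1) := by
    have h := card_subtype_card_le_pow R p
    rw [← hN] at h
    exact_mod_cast h
  calc ((k - 1 : ℕ) : ℝ) ^ m - ((k - 1 : ℕ) : ℝ) ≤ N * (((k - 1 : ℕ) : ℝ) ^ m * θ) := hlb
    _ ≤ ((R : ℝ) + 1) ^ (p + 1) * (((k - 1 : ℕ) : ℝ) ^ m * θ) := mul_le_mul_of_nonneg_right hNle hθ


/-- **Codimension theorem, fixed `m`** (registered form of `codim_terms_lower_bound_of_catch`). [new] -/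
theorem codim_terms_lower_bound : ∀ {m k R p : ℕ}, 3 ≤ k → k + 2 ≤ m → ∀ (U : (Edge m → Bool) → Fin R → ℝ) (V : Fin R → Finset (Fin m) → ℝ), (∀ u l, 0 ≤ U u l) → (∀ l (Q : Finset (Fin m)), Q.card = k → 0 ≤ V l Q) → ∀ (ε : ℝ), 0 < ε → (∀ (Q : Finset (Fin m)) (u : Edge m → Bool), Q.card = k → cliqueFn m k u = false → cdist Q u - ε = ∑ l, U u l * V l Q) → (∀ s : Finset (Fin R), s.card = p + 1 → ∃ h : Fin R → ℝ, (∀ l, l ∉ s → h l = 0) ∧ h ≠ 0 ∧ ∃ t : Edge m → ℝ, ∀ Q : Finset (Fin m), Q.card = k → ∑ l, h l * V l Q = ∑ e, (if cliqueVec Q e = true then t e else 0)) → ∀ (θ : ℝ), (∀ w : Edge m → ℝ, (∀ Q ∈ (Finset.univ : Finset (Fin m)).powersetCard k, 0 ≤ softWindow w Q) → ((((Finset.univ : Finset (Fin m → Fin (k - 1))).filter fun c => ∑ e, (if colorVec c e = true then w e else 0) < 0).card : ℝ)) ≤ ((k - 1 : ℕ) : ℝ) ^ m * θ) → ((k - 1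 : ℕ) : ℝ) ^ m - ((k - 1 : ℕ) : ℝ) ≤ ((R : ℝ) + 1) ^ (p + 1) * (((k - 1 : ℕ) : ℝ) ^ m * θ) :=
  fun hk hm U V hU hV ε hε hfact hP θ hcatch => codim_terms_lower_bound_of_catch hk hm U V hU hV ε hε hfact hP θ hcatch

end

end Summit.PneNP.PneNP.Theorems
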